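import Summits.QuantumFields.YangMills.Theorems.AlphaInputsT3ACv3RegionalThm1CarrierData
import Summits.QuantumFields.YangMills.Theorems.AlphaInputsT3ACv3LocalSmallExact
import HarnessLib

/-!
# `AlphaInputsT3ACv3RegionalDataContinuity` — B1 EDGES-A v2, FILE 1 (generic half): THE CROSS-BOUNDARY DATUM OF [Balaban1985Variational] (7) IS
# CONTINUOUS IN THE MULTI-LEVEL DATA ON THE ONE-STEP SMALL-LOOP CLASS, (7) READ WITH `≤` IS CLOSED THERE, AND ON THE LOCAL SMALL-LOOP CORE THE
# NORMALISED DATUM MAP `datumE` IS CONTINUOUS AND THE CONSTRAINT (3) IS CLOSED — generic over `P`, a topological gauge group `G`, a small-loop average `ℰ`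

Cell `ym3-torus` (HUMAN RULING D-0037; YM ladder rung R3 = finite-torus SU(2) YM₃, NOT the Clay problem), width seat `ym-ust-19936-w2` (gen 6) on
stmt-QuantumFields-19936 `HistoryTailL`; LEAD ★w1-19936 g4 RULING L-R6 (2026-08-28T11:22Z) «EDGES-A v2 goes ahead: FILE 2 (LEAD) the display
`NestedRegularSelT3R7` over the (7)-set `data7Set`, FILE 1 (this seat) the closedness rows (C1)–(C3) of the B1 STATEMENT SPEC memo
`B1-STATEMENT-SPEC-w2g6.md` (19936 evidence #47) §4».  This is the GENERIC half of FILE 1 (the T³ instance is `…v3Data7Closed`, split for the 400-line rule).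
`--supports stmt-QuantumFields-19936 --as helper`; def-free; count-neutral.

WHY.  B1 of NODE O d = 3 must EXHIBIT print's (42)-minimiser as a MEASURABLE map `W ↦ U_k(h; W, 𝓥*(W))` at a measurable admissible frozen-data
selection `𝓥*` ([Balaban1985UV3] (42) p.266 «`Ū_kʲ = V_j` on `Λ_j`, `j = 0,…,k`, where we have put `Λ₀ = Ω₁ᶜ`»; [Balaban1985Variational] (2)–(8) pp.278–279).
The tree's selection theorems — ✓ `FrozenSelection.exists_frozenSelector` (a measurable `𝓥*` INTO a CLOSED admissible set with prescribed top datum) and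
✓ `exists_measurable_argmin_closedClass` (a measurable argmin over a CLOSED class cut by a closed constraint, [AliprantisBorder2006] Thm 18.19) — each owe
ONE topological input; this file supplies the generic continuity∕closedness behind them for the letters of ✓ `AlphaInputsT3ACv3RegionalThm1Carrier`
(`RegionalVP.Reg7On`, `ConstraintOn`, `datumAt`∕`mixedDatum`) and ✓ `…RegionalThm1CarrierData` (`RegionalVP.datumE`):
* §1 the cross-boundary datum `datumAt (blockAvg ℰ) Λ 𝓥 j` ([Balaban1985Variational] p.278 «if `p′` intersects the boundary of `Λ_j` … we replace `V_b` by `V̄_b`») is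
  CONTINUOUS in the data `𝓥` on the ONE-STEP SMALL-LOOP CLASS «every frozen level `i < k` has `(0.4)`-loop variables within `δ′ < ℰ.δ`» (`continuousOn_datumAt`),
  because there the guarded average of record IS the unguarded one (✓ `SubstrateBlockAvgContinuity.avg_eq_rawAvg_of_small` ∕ `continuousOn_rawAvg_eval`); hence
  print's (7), read with `≤` and level radii `ε₁ j`, cuts that class in a CLOSED set (`isClosed_smallLoopData_inter_reg7OnLe`).
* §2 on the local small-loop core `LocalSmallLoop.NestedSmallOn ℰ δ′ E k` of ANY exactly dependency-closed bond family `E` containing the bonds the constraint (3)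
  reads (`bondsOn j (Λ j)`, `j ≤ k`), the normalised datum map `U ↦ datumE (blockAvg ℰ) k Λ U` is CONTINUOUS (product topology on `(j : ℕ) → GaugeField P j G`;
  `continuousOn_datumE`) and the constraint set `{U | ConstraintOn … 𝓥 U}` is CLOSED relative to the core (`isClosed_nestedSmallOn_inter_constraintOn`) —
  ✓ `LocalSmallLoop.continuousOn_iter_eval₂` ∕ `isClosed_nestedSmallOn_inter_eq₂` BY NAME.
HONEST FRAMING.  Topology∕bookkeeping only; no estimate of [Balaban1985UV3]∕[Balaban1985Variational] is asserted; B1, EDGES-B, NODE O, the stub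
`AlphaInputsT3ACv4RecChi` and the crux `HistoryTailL` are NOT claimed.  The core is LOCAL (small loops on the cone of the read bonds only — the global class
`NestedSmall` could exclude print's pinned minimiser, whose frozen data's HIGHER averages off `Ω_j` need not have small loops).  YM₃ on the three-torus is rung
R3 of the programme, NOT the Clay problem: nothing here bears on d = 4, infinite volume, or a mass gap.

References: T. Bałaban, Commun. Math. Phys. 102 (1985) 277–309 [Balaban1985Variational] ((2)–(3), (7) p.278, Thm 1 (8) p.279); Commun. Math. Phys. 102 (1985)
255–275 [Balaban1985UV3] ((40)–(42) p.266); Commun. Math. Phys. 109 (1987) 249–301 [Balaban1987RG1] ((0.4) p.253).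
-/

set_option autoImplicit false

noncomputable section

/-! ## §1 Generic: the cross-boundary datum is continuous on the one-step small-loop class; (7) with `≤` is closed relative to it -/

namespace Summit.QuantumFields.YangMills.Theorems.RegionalVP

open Set Topology
open Literature.MathematicalPhysics.QuantumFieldTheory.Balaban1983to89
open Literature.MathematicalPhysics.QuantumFieldTheory.Balaban1983to89.BlockAveraging (blockAvg Small loopHol Idx)
open Literature.MathematicalPhysics.QuantumFieldTheory.Balaban1983to89.B10Eq38TorusDomains (cornerSet)
open Summit.QuantumFields.BalabanUV.T4Continuum.SubstrateBlockAvgContinuity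
  (rawAvg avg_eq_rawAvg_of_small continuousOn_rawAvg_eval continuous_loopHol SmallContinuous)
open Summit.QuantumFields.YangMills.Theorems.BalabanUVNodesN08AlphaGroupTopology (continuous_plaqHol)
open Summit.QuantumFields.YangMills.Theorems.LocalSmallLoop (NestedSmallOn DepClosed₂ isClosed_nestedSmallOn₂ continuousOn_iter_eval₂
  isClosed_nestedSmallOn_inter_eq₂)

variable {P : Params} {G : Type*} [GaugeGroup G] [TopologicalSpace G] [IsTopologicalGroup G]

/-- **THE ONE-STEP SMALL-LOOP CLASS OF MULTI-LEVEL DATA IS CLOSED**: «for every level `i < k`, every bond `c` of `T^{(i+1)}` and every loop index `x`,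
`|loopHol (𝓥 i) c x − 1| ≤ δ′`» is a closed subset of `(j : ℕ) → GaugeField P j G` (product topology; continuous `dist1`). [cite: Balaban1987RG1, (0.4) p.253] -/
theorem isClosed_smallLoopData (hd : Continuous (dist1 : G → ℝ)) (k : ℕ) (δ' : ℝ) :
    IsClosed {𝓥 : (j : ℕ) → GaugeField P j G | ∀ i, i < k → ∀ (c : PBond P (i + 1)) (x : Idx P), dist1 (loopHol (𝓥 i) c x) ≤ δ'} := by
  have hset : {𝓥 : (j : ℕ) → GaugeField P j G | ∀ i, i < k → ∀ (c : PBond P (i + 1)) (x : Idx P), dist1 (loopHol (𝓥 i) c x) ≤ δ'} =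
      ⋂ (i : ℕ), ⋂ (_ : i < k), ⋂ (c : PBond P (i + 1)), ⋂ (x : Idx P),
        {𝓥 : (j : ℕ) → GaugeField P j G | dist1 (loopHol (𝓥 i) c x) ≤ δ'} := by
    ext 𝓥
    simp only [mem_setOf_eq, mem_iInter]
  rw [hset]
  exact isClosed_iInter fun i => isClosed_iInter fun _ => isClosed_iInter fun c => isClosed_iInter fun x =>
    isClosed_le (hd.comp ((continuous_loopHol c x).comp (continuous_apply i))) continuous_const

/-- **ON THE SMALL-LOOP GUARD THE ONE-STEP AVERAGE OF RECORD OF A FROZEN LEVEL IS CONTINUOUS IN THE DATA** (bondwise): on `{𝓥 | ∀ x, |loopHol (𝓥 i) c x − 1| ≤ δ′}`,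
`δ′ < ℰ.δ`, the guarded (0.4) average `(blockAvg ℰ).avg (𝓥 i) c` equals the unguarded one (`avg_eq_rawAvg_of_small`) and the latter is continuous there
(`continuousOn_rawAvg_eval`). [cite: Balaban1987RG1, (0.4) p.253] -/
theorem continuousOn_blockAvg_apply_level (ℰ : LoopAverage G) (hE : SmallContinuous ℰ) {δ' : ℝ} (hδ : δ' < ℰ.δ) (i : ℕ) (c : PBond P (i + 1)) :
    ContinuousOn (fun 𝓥 : (j : ℕ) → GaugeField P j G => (blockAvg ℰ : Averaging P i G).avg (𝓥 i) c)
      {𝓥 : (j : ℕ) → GaugeField P j G | ∀ x : Idx P, dist1 (loopHol (𝓥 i) c x) ≤ δ'} := by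
  have hsmall : ∀ 𝓥 : (j : ℕ) → GaugeField P j G, (∀ x : Idx P, dist1 (loopHol (𝓥 i) c x) ≤ δ') → Small ℰ (𝓥 i) c :=
    fun 𝓥 h x => (h x).trans_lt hδ
  have hraw : ContinuousOn (fun 𝓥 : (j : ℕ) → GaugeField P j G => rawAvg ℰ (𝓥 i) c)
      {𝓥 : (j : ℕ) → GaugeField P j G | ∀ x : Idx P, dist1 (loopHol (𝓥 i) c x) ≤ δ'} :=
    (continuousOn_rawAvg_eval ℰ hE c).comp (continuous_apply i).continuousOn fun 𝓥 h => hsmall 𝓥 h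
  exact hraw.congr fun 𝓥 h => avg_eq_rawAvg_of_small ℰ (hsmall 𝓥 h)

/-- **THE CROSS-BOUNDARY DATUM OF LEVEL `i+1` IS CONTINUOUS IN THE DATA** on the class where the frozen level `i` has `δ′`-small loops at every bond: on the bonds
lying on `Λ_{i+1}` it is the datum (an evaluation), elsewhere the one-step average of level `i`. [cite: Balaban1985Variational, (7) p.278] -/
theorem continuousOn_mixedDatum (ℰ : LoopAverage G) (hE : SmallContinuous ℰ) {δ' : ℝ} (hδ : δ' < ℰ.δ) (Λsucc : Set (Site P 0)) (i : ℕ) :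
    ContinuousOn (fun 𝓥 : (j : ℕ) → GaugeField P j G => mixedDatum (fun j => (blockAvg ℰ : Averaging P j G)) Λsucc i 𝓥)
      {𝓥 : (j : ℕ) → GaugeField P j G | ∀ (c : PBond P (i + 1)) (x : Idx P), dist1 (loopHol (𝓥 i) c x) ≤ δ'} := by
  refine continuousOn_pi.2 fun b => ?_
  by_cases hb : b ∈ bondsOn (i + 1) Λsucc
  · have heq : (fun 𝓥 : (j : ℕ) → GaugeField P j G => mixedDatum (fun j => (blockAvg ℰ : Averaging P j G)) Λsucc i 𝓥 b) =
        fun 𝓥 => 𝓥 (i + 1) b := funext fun 𝓥 => mixedDatum_of_mem hb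
    rw [heq]
    exact ((continuous_apply b).comp (continuous_apply (i + 1))).continuousOn
  · have heq : (fun 𝓥 : (j : ℕ) → GaugeField P j G => mixedDatum (fun j => (blockAvg ℰ : Averaging P j G)) Λsucc i 𝓥 b) =
        fun 𝓥 => (blockAvg ℰ : Averaging P i G).avg (𝓥 i) b := funext fun 𝓥 => mixedDatum_of_not_mem hb
    rw [heq]
    exact (continuousOn_blockAvg_apply_level ℰ hE hδ i b).mono fun 𝓥 h => h b

/-- **THE DATUM READ BY (7) AT EVERY LEVEL `j ≤ k` IS CONTINUOUS IN THE DATA ON THE ONE-STEP SMALL-LOOP CLASS** (levels `< k` guarded): level `0` is an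
evaluation, level `j+1 ≤ k` is the cross-boundary datum of `continuousOn_mixedDatum`. [cite: Balaban1985Variational, (7) p.278] -/
theorem continuousOn_datumAt (ℰ : LoopAverage G) (hE : SmallContinuous ℰ) {δ' : ℝ} (hδ : δ' < ℰ.δ) (k : ℕ) (Λ : ℕ → Set (Site P 0)) :
    ∀ j : ℕ, j ≤ k → ContinuousOn (fun 𝓥 : (j : ℕ) → GaugeField P j G => datumAt (fun j => (blockAvg ℰ : Averaging P j G)) Λ 𝓥 j)
      {𝓥 : (j : ℕ) → GaugeField P j G | ∀ i, i < k → ∀ (c : PBond P (i + 1)) (x : Idx P), dist1 (loopHol (𝓥 i) c x) ≤ δ'}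
  | 0, _ => by
    have heq : (fun 𝓥 : (j : ℕ) → GaugeField P j G => datumAt (fun j => (blockAvg ℰ : Averaging P j G)) Λ 𝓥 0) = fun 𝓥 => 𝓥 0 := rfl
    rw [heq]
    exact (continuous_apply 0).continuousOn
  | j + 1, hj => by
    have heq : (fun 𝓥 : (j : ℕ) → GaugeField P j G => datumAt (fun j => (blockAvg ℰ : Averaging P j G)) Λ 𝓥 (j + 1)) =
        fun 𝓥 => mixedDatum (fun j => (blockAvg ℰ : Averaging P j G)) (Λ (j + 1)) j 𝓥 := rfl
    rw [heq]
    exact (continuousOn_mixedDatum ℰ hE hδ (Λ (j + 1)) j).mono fun 𝓥 h c x => h j (Nat.lt_of_succ_le hj) c x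

/-- **PRINT'S (7), READ WITH `≤` AND LEVEL RADII `ε₁ j`, CUTS THE ONE-STEP SMALL-LOOP CLASS IN A CLOSED SET**: for every `j ≤ k` and every plaquette `p′` of
`T^{(j)}` touching `Λ_j` and (below the top) avoiding `Ω_{j+1}`, `|∂V(p′) − 1| ≤ ε₁ j` with `∂V` read through the cross-boundary datum — finitely many `≤`-conditions on maps
continuous ON the class. [cite: Balaban1985Variational, (7) p.278] -/
theorem isClosed_smallLoopData_inter_reg7OnLe (hd : Continuous (dist1 : G → ℝ)) (ℰ : LoopAverage G) (hE : SmallContinuous ℰ) {δ' : ℝ}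
    (hδ : δ' < ℰ.δ) (k : ℕ) (Ω Λ : ℕ → Set (Site P 0)) (ε₁ : ℕ → ℝ) :
    IsClosed ({𝓥 : (j : ℕ) → GaugeField P j G | ∀ i, i < k → ∀ (c : PBond P (i + 1)) (x : Idx P), dist1 (loopHol (𝓥 i) c x) ≤ δ'} ∩
      {𝓥 : (j : ℕ) → GaugeField P j G | ∀ j, j ≤ k → ∀ p : Plaq P j, (cornerSet j p ∩ Λ j).Nonempty → (j < k → cornerSet j p ∩ Ω (j + 1) = ∅) →
        dist1 (GaugeField.plaqHol (datumAt (fun j => (blockAvg ℰ : Averaging P j G)) Λ 𝓥 j) p) ≤ ε₁ j}) := by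
  have hA := isClosed_smallLoopData (P := P) hd k δ'
  have hset :
      ({𝓥 : (j : ℕ) → GaugeField P j G | ∀ i, i < k → ∀ (c : PBond P (i + 1)) (x : Idx P), dist1 (loopHol (𝓥 i) c x) ≤ δ'} ∩
        {𝓥 : (j : ℕ) → GaugeField P j G | ∀ j, j ≤ k → ∀ p : Plaq P j, (cornerSet j p ∩ Λ j).Nonempty → (j < k → cornerSet j p ∩ Ω (j + 1) = ∅) →
          dist1 (GaugeField.plaqHol (datumAt (fun j => (blockAvg ℰ : Averaging P j G)) Λ 𝓥 j) p) ≤ ε₁ j}) =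
      {𝓥 : (j : ℕ) → GaugeField P j G | ∀ i, i < k → ∀ (c : PBond P (i + 1)) (x : Idx P), dist1 (loopHol (𝓥 i) c x) ≤ δ'} ∩
        ⋂ (j : ℕ), ⋂ (_ : j ≤ k), ⋂ (p : Plaq P j), ⋂ (_ : (cornerSet j p ∩ Λ j).Nonempty), ⋂ (_ : j < k → cornerSet j p ∩ Ω (j + 1) = ∅),
          ({𝓥 : (j : ℕ) → GaugeField P j G | ∀ i, i < k → ∀ (c : PBond P (i + 1)) (x : Idx P), dist1 (loopHol (𝓥 i) c x) ≤ δ'} ∩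
            {𝓥 : (j : ℕ) → GaugeField P j G |
              dist1 (GaugeField.plaqHol (datumAt (fun j => (blockAvg ℰ : Averaging P j G)) Λ 𝓥 j) p) ≤ ε₁ j}) := by
    ext 𝓥
    simp only [mem_inter_iff, mem_setOf_eq, mem_iInter]
    constructor
    · rintro ⟨hs, h⟩
      exact ⟨hs, fun j hj p h₁ h₂ => ⟨hs, h j hj p h₁ h₂⟩⟩
    · rintro ⟨hs, h⟩
      exact ⟨hs, fun j hj p h₁ h₂ => (h j hj p h₁ h₂).2⟩
  rw [hset]
  exact hA.inter (isClosed_iInter fun j => isClosed_iInter fun hj => isClosed_iInter fun p => isClosed_iInter fun _ =>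
    isClosed_iInter fun _ => ((hd.comp (continuous_plaqHol p)).comp_continuousOn
      (continuousOn_datumAt ℰ hE hδ k Λ j hj)).preimage_isClosed_of_isClosed hA isClosed_Iic)

/-! ## §2 Generic: on the local small-loop core the normalised datum map is continuous and the constraint (3) is closed -/

/-- **(C3) THE NORMALISED DATUM MAP IS CONTINUOUS ON THE LOCAL SMALL-LOOP CORE**: for an exactly dependency-closed bond family `E` containing the bonds the
multi-level constraint reads (`bondsOn j (Λ j) ⊆ E j`, `j ≤ k`, `k` in the standing range), `U ↦ datumE (blockAvg ℰ) k Λ U` is continuous on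
`NestedSmallOn ℰ δ′ E k` into `(j : ℕ) → GaugeField P j G` (product topology): each read component is an `s`-fold average at a bond of `E s`
(`LocalSmallLoop.continuousOn_iter_eval₂`), every other component is the constant `1`. [cite: Balaban1985UV3, (42) p.266; Balaban1987RG1, (0.4) p.253] -/
theorem continuousOn_datumE (hd : Continuous (dist1 : G → ℝ)) (ℰ : LoopAverage G) (hE' : SmallContinuous ℰ) {δ' : ℝ} (hδ : δ' < ℰ.δ)
    {E : (i : ℕ) → Set (PBond P i)} (hE : DepClosed₂ E) {k : ℕ} (hk : k ≤ P.m + P.K) (Λ : ℕ → Set (Site P 0))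
    (hread : ∀ j, j ≤ k → bondsOn j (Λ j) ⊆ E j) :
    ContinuousOn (fun U : GaugeField P 0 G => datumE (fun j => (blockAvg ℰ : Averaging P j G)) k Λ U) (NestedSmallOn ℰ δ' E k) := by
  refine continuousOn_pi.2 fun j => continuousOn_pi.2 fun b => ?_
  by_cases h : j ≤ k ∧ b ∈ bondsOn j (Λ j)
  · have heq : (fun U : GaugeField P 0 G => datumE (fun j => (blockAvg ℰ : Averaging P j G)) k Λ U j b) =
        fun U => Averaging.iter (fun j => (blockAvg ℰ : Averaging P j G)) j U b := funext fun U => datumE_of_mem h.1 h.2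
    rw [heq]
    exact continuousOn_iter_eval₂ hd hE' hδ hE hk h.1 (hread j h.1 h.2)
  · have heq : (fun U : GaugeField P 0 G => datumE (fun j => (blockAvg ℰ : Averaging P j G)) k Λ U j b) = fun _ => (1 : G) :=
      funext fun U => datumE_of_not h
    rw [heq]
    exact continuousOn_const

/-- **THE MULTI-LEVEL CONSTRAINT (3) IS CLOSED RELATIVE TO THE LOCAL SMALL-LOOP CORE** (`G` Hausdorff): «`(blockAvg ℰ)ʲ U = 𝓥_j` on the bonds lying on `Λ_j`, `j ≤ k`»
is finitely many equalities at bonds of `E`, each closed relative to the core (`LocalSmallLoop.isClosed_nestedSmallOn_inter_eq₂`).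
[cite: Balaban1985Variational, (3) p.278; Balaban1985UV3, (42) p.266] -/
theorem isClosed_nestedSmallOn_inter_constraintOn [T2Space G] (hd : Continuous (dist1 : G → ℝ)) (ℰ : LoopAverage G) (hE' : SmallContinuous ℰ)
    {δ' : ℝ} (hδ : δ' < ℰ.δ) {E : (i : ℕ) → Set (PBond P i)} (hE : DepClosed₂ E) {k : ℕ} (hk : k ≤ P.m + P.K) (Λ : ℕ → Set (Site P 0))
    (hread : ∀ j, j ≤ k → bondsOn j (Λ j) ⊆ E j) (𝓥 : (j : ℕ) → GaugeField P j G) :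
    IsClosed (NestedSmallOn ℰ δ' E k ∩ {U : GaugeField P 0 G | ConstraintOn (fun j => (blockAvg ℰ : Averaging P j G)) k Λ 𝓥 U}) := by
  have hN := isClosed_nestedSmallOn₂ (P := P) hd hE' hδ hE hk
  have hset : NestedSmallOn ℰ δ' E k ∩ {U : GaugeField P 0 G | ConstraintOn (fun j => (blockAvg ℰ : Averaging P j G)) k Λ 𝓥 U} =
      NestedSmallOn ℰ δ' E k ∩ ⋂ (j : ℕ), ⋂ (_ : j ≤ k), ⋂ (b : PBond P j), ⋂ (_ : b ∈ bondsOn j (Λ j)),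
        (NestedSmallOn ℰ δ' E k ∩ {U : GaugeField P 0 G | Averaging.iter (fun j => (blockAvg ℰ : Averaging P j G)) j U b = 𝓥 j b}) := by
    ext U
    simp only [ConstraintOn, mem_inter_iff, mem_setOf_eq, mem_iInter]
    constructor
    · rintro ⟨hs, h⟩
      exact ⟨hs, fun j hj b hb => ⟨hs, h j hj b hb⟩⟩
    · rintro ⟨hs, h⟩
      exact ⟨hs, fun j hj b hb => (h j hj b hb).2⟩
  rw [hset]
  exact hN.inter (isClosed_iInter fun j => isClosed_iInter fun hj => isClosed_iInter fun b => isClosed_iInter fun hb =>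
    isClosed_nestedSmallOn_inter_eq₂ hd hE' hδ hE hk hj (hread j hj hb) (𝓥 j b))

end Summit.QuantumFields.YangMills.Theorems.RegionalVP

end
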